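import Mathlib
import HarnessLib
import Summits.ValiantsHypothesis.ValiantsHypothesis.Theorems.LacunarySymmetroidMatrixDescartesProductPlusOneCrossingInterlace
import Summits.ValiantsHypothesis.ValiantsHypothesis.Theorems.LacunarySymmetroidMatrixDescartesProductPlusOnePosCoeff

/-!
# ValiantsHypothesis / LacunarySymmetroid — crux `MatrixDescartes` (stmt-ValiantsHypothesis-18050, V1),
# LINE (A) «product_plus_one», floor: THE FLOOR AS A BUDGET ON ONE POLYNOMIAL (val-idea-25 g3 memo §14, asks N1–N3)

With ✓ `…CrossingInterlace` (zeros of `E = X·P′ − C ν·P` and zeros of the log-Wronskian `W(P) = P·θ²P − (θP)²` interlace inside every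
pole-free window) the window / coupling bookkeeping of the floor collapses to ONE global inequality per polynomial:

* ★ `card_posRoots_thetaSub_le_wronskian_add` (N1; EVERY `P ∈ ℝ[X]`, every level `ν`):
  `Z₊(X·P′ − C ν·P) ≤ Z₊(W(P)) + 2·Z₊(P) + 1` — between two positive zeros of `E` off `Z(P)` lies a positive zero of `P` or a positive zero of
  `W(P)` (✓ `exists_wronskian_root_between_zeros`), so ✓ `card_le_card_add_one_of_between` applies with separator set `Z₊(W(P)) ∪ Z₊(P)`; the
  zeros of `E` AT the poles are at most `Z₊(P)` more;
* ★ `card_posRoots_eulerNumerator_le_wronskian_add` (N2): the same for the line's `eulerNumerator d a l₀` (unfolded) and `P = ∏_j Σ_l C a_{jl} X^{d_l}`,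
  for EVERY coupling `l₀` at once (✓ `eulerNumerator_eq_general`);
* `coeff_fewnomial_three`, `countP_pos_roots_trinomial_le_one` (Descartes: a ONE-CHANGE trinomial row — no strict dip `a₀a₁ < 0 ∧ a₁a₂ < 0` — has at
  most one positive zero, with multiplicity; ✓ `countP_pos_roots_le_one_of_extreme`), ★ `card_posRoots_prod_le_of_oneChange` (N3): for a K = 3 company of
  one-change rows on `d 0 < d 1 < d 2`, `Z₊(∏_j f_j) ≤ m`;
* ★★ `card_posRoots_eulerNumerator_le_wronskian_add_of_oneChange` (N2 + N3): for such a company and every coupling,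
  `Z₊(eulerNumerator d a l₀) ≤ Z₊(W(∏_j f_j)) + 2m + 1` — so the floor `OneChangeFloorK3` follows from ANY linear bound on the positive zeros of the ONE
  polynomial `W(∏_j fewnomial d (a j))` (val-idea-25's EB2-W, CONJECTURE/TEXT), coupling-free and window-free.

HONEST FRAMING: counting frame + Descartes bookkeeping; EB2-W is NOT proved here; NOT `OneChangeFloorK3`, not `stub_classRowK3`, not `stub_eulerBoundK3`,
not `stub_polyLaw`, not `MatrixDescartes`, not Conjecture B; `VP ≠ VNP` is NOT proved.  No definitions, no named facts; Mathlib + ✓ `…CrossingInterlace` +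
✓ `…PosCoeff` only.
-/

set_option linter.dupNamespace false

namespace Summit.ValiantsHypothesis.ValiantsHypothesis.Theorems.LacunarySymmetroidMatrixDescartes

namespace ProductPlusOne

open Polynomial Finset
open scoped BigOperators

/-! ### §1 N1 — every polynomial: `Z₊(X·P′ − C ν·P) ≤ Z₊(W(P)) + 2·Z₊(P) + 1` -/

/-- ★ **N1 (val-idea-25 g3 §14): for EVERY real polynomial `P` and every level `ν`,
`Z₊(X·P′ − C ν·P) ≤ Z₊(P·X(XP′)′ − (XP′)²) + 2·Z₊(P) + 1`** (positive zeros counted without multiplicity). [this file's theorem] -/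
theorem card_posRoots_thetaSub_le_wronskian_add (P : ℝ[X]) (ν : ℝ) :
    ((X * derivative P - C ν * P).roots.toFinset.filter (fun t => 0 < t)).card
      ≤ ((P * (X * derivative (X * derivative P)) - (X * derivative P) ^ 2).roots.toFinset.filter (fun t => 0 < t)).card
        + 2 * (P.roots.toFinset.filter (fun t => 0 < t)).card + 1 := by
  classical
  set E : ℝ[X] := X * derivative P - C ν * P with hE
  set N : ℝ[X] := P * (X * derivative (X * derivative P)) - (X * derivative P) ^ 2 with hN
  set R := P.roots.toFinset.filter (fun t => 0 < t) with hR
  set ZN := N.roots.toFinset.filter (fun t => 0 < t) with hZN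
  by_cases hE0 : E = 0
  · have : (E.roots.toFinset.filter (fun t => 0 < t)) = ∅ := by
      rw [hE0, roots_zero, Multiset.toFinset_zero, Finset.filter_empty]
    rw [this, Finset.card_empty]; exact Nat.zero_le _
  have hP0 : P ≠ 0 := by
    rintro rfl
    exact hE0 (by rw [hE]; simp)
  set ZE := E.roots.toFinset.filter (fun t => 0 < t) with hZE
  -- split the positive zeros of `E` into those OFF the poles (`T`) and those AT poles (`T'`)
  set T := ZE.filter (fun t => P.eval t ≠ 0) with hT
  set T' := ZE.filter (fun t => ¬ P.eval t ≠ 0) with hT'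
  have hsplit : T.card + T'.card = ZE.card := Finset.card_filter_add_card_filter_not _
  have hT'le : T'.card ≤ R.card := by
    refine Finset.card_le_card fun t ht => ?_
    rw [hT', Finset.mem_filter, not_not] at ht
    rw [hR, Finset.mem_filter, Multiset.mem_toFinset, mem_roots hP0]
    exact ⟨ht.2, (Finset.mem_filter.mp ht.1).2⟩
  -- between two positive zeros of `E` off the poles lies a positive zero of `P` or of `W(P)`
  have hTle : T.card ≤ (ZN ∪ R).card + 1 := by
    refine card_le_card_add_one_of_between T (ZN ∪ R) fun z hz z' hz' hzz' => ?_
    rw [hT, Finset.mem_filter, hZE, Finset.mem_filter, Multiset.mem_toFinset, mem_roots hE0] at hz hz'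
    obtain ⟨⟨hEz, hz0⟩, hPz⟩ := hz
    obtain ⟨⟨hEz', _⟩, hPz'⟩ := hz'
    by_cases hpole : ∃ r ∈ R, z < r ∧ r < z'
    · obtain ⟨r, hr, hzr, hrz'⟩ := hpole
      exact ⟨r, Finset.mem_union_right _ hr, hzr, hrz'⟩
    · push Not at hpole
      have hPI : ∀ t ∈ Set.Icc z z', P.eval t ≠ 0 := by
        intro t ht hPt
        rcases eq_or_lt_of_le ht.1 with h1 | h1
        · exact hPz (h1 ▸ hPt)
        rcases eq_or_lt_of_le ht.2 with h2 | h2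
        · exact hPz' (h2 ▸ hPt)
        have htR : t ∈ R := by
          rw [hR, Finset.mem_filter, Multiset.mem_toFinset, mem_roots hP0]
          exact ⟨hPt, hz0.trans h1⟩
        exact absurd h2 (not_lt.mpr (hpole t htR h1))
      obtain ⟨hN0, w, hw, hNw⟩ := exists_wronskian_root_between_zeros P ν hE0 hz0 hzz' hPI hEz hEz'
      refine ⟨w, Finset.mem_union_left _ ?_, hw.1, hw.2⟩
      rw [hZN, Finset.mem_filter, Multiset.mem_toFinset, mem_roots hN0]
      exact ⟨hNw, hz0.trans hw.1⟩
  have hunion : (ZN ∪ R).card ≤ ZN.card + R.card := Finset.card_union_le _ _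
  omega

/-- ★ **N2: the same budget for the line's Euler numerator** `eulerNumerator d a l₀` (unfolded) and `P = ∏_j Σ_l C a_{jl} X^{d_l}`, for EVERY coupling `l₀`
(✓ `eulerNumerator_eq_general`: `R = X·P′ − C(m·d_{l₀})·P`). [this file's theorem] -/
theorem card_posRoots_eulerNumerator_le_wronskian_add {m K : ℕ} (d : Fin K → ℕ) (a : Fin m → Fin K → ℝ) (l₀ : Fin K) :
    ((∑ j, (∑ l, C (a j l * ((d l : ℝ) - d l₀)) * X ^ (d l)) * ∏ i ∈ Finset.univ.erase j, (∑ l, C (a i l) * X ^ (d l))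
        : ℝ[X]).roots.toFinset.filter (fun t => 0 < t)).card
      ≤ (((∏ j, ∑ l, C (a j l) * X ^ (d l) : ℝ[X]) * (X * derivative (X * derivative (∏ j, ∑ l, C (a j l) * X ^ (d l) : ℝ[X])))
            - (X * derivative (∏ j, ∑ l, C (a j l) * X ^ (d l) : ℝ[X])) ^ 2).roots.toFinset.filter (fun t => 0 < t)).card
        + 2 * ((∏ j, ∑ l, C (a j l) * X ^ (d l) : ℝ[X]).roots.toFinset.filter (fun t => 0 < t)).card + 1 := by
  rw [eulerNumerator_eq_general]
  exact card_posRoots_thetaSub_le_wronskian_add _ _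

/-! ### §2 N3 — Descartes for one-change trinomial rows: `Z₊(∏_j f_j) ≤ m` -/

/-- Coefficients of a `K = 3` fewnomial. [folklore] -/
theorem coeff_fewnomial_three (d : Fin 3 → ℕ) (b : Fin 3 → ℝ) (i : ℕ) :
    (∑ l, C (b l) * X ^ (d l) : ℝ[X]).coeff i
      = (if i = d 0 then b 0 else 0) + (if i = d 1 then b 1 else 0) + (if i = d 2 then b 2 else 0) := by
  simp only [Fin.sum_univ_three, coeff_add, coeff_C_mul_X_pow]

/-- Descartes for a one-change trinomial whose MIDDLE coefficient is non-negative: at most one positive zero, with multiplicity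
(`d 0 < d 1 < d 2`; no strict dip `b₀b₁ < 0 ∧ b₁b₂ < 0`). [folklore; ✓ `countP_pos_roots_le_one_of_extreme`] -/
theorem countP_pos_roots_trinomial_le_one_of_middle_nonneg (d : Fin 3 → ℕ) (h01 : d 0 < d 1) (h12 : d 1 < d 2) (b : Fin 3 → ℝ)
    (hb1 : 0 ≤ b 1) (hone : ¬ (b 0 * b 1 < 0 ∧ b 1 * b 2 < 0)) :
    (∑ l, C (b l) * X ^ (d l) : ℝ[X]).roots.countP (fun t => 0 < t) ≤ 1 := by
  set Q : ℝ[X] := ∑ l, C (b l) * X ^ (d l) with hQ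
  have hc : ∀ i, Q.coeff i = (if i = d 0 then b 0 else 0) + (if i = d 1 then b 1 else 0) + (if i = d 2 then b 2 else 0) :=
    fun i => coeff_fewnomial_three d b i
  have h02 : d 0 < d 2 := h01.trans h12
  -- three sign configurations
  by_cases hb0 : 0 ≤ b 0
  · -- only the TOP coefficient may be negative
    refine countP_pos_roots_le_one_of_extreme Q (d 2) (fun i hi => ?_) (Or.inr fun i hi => ?_)
    · rw [hc i, if_neg hi]
      refine add_nonneg (add_nonneg ?_ ?_) le_rfl <;> split_ifs <;> first | exact hb0 | exact hb1 | exact le_rfl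
    · rw [hc i, if_neg (by omega), if_neg (by omega), if_neg (by omega)]; ring
  · push Not at hb0
    by_cases hb2 : 0 ≤ b 2
    · -- only the BOTTOM coefficient is negative
      refine countP_pos_roots_le_one_of_extreme Q (d 0) (fun i hi => ?_) (Or.inl fun i hi => ?_)
      · rw [hc i, if_neg hi]
        refine add_nonneg (add_nonneg le_rfl ?_) ?_ <;> split_ifs <;> first | exact hb1 | exact hb2 | exact le_rfl
      · rw [hc i, if_neg (by omega), if_neg (by omega), if_neg (by omega)]; ring
    · push Not at hb2
      -- `b 0 < 0`, `b 2 < 0`, `b 1 ≥ 0`: the one-change hypothesis forces `b 1 = 0`; then `−Q` has non-negative coefficients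
      have hb1z : b 1 = 0 := by
        by_contra h
        have hb1p : 0 < b 1 := lt_of_le_of_ne hb1 (Ne.symm h)
        exact hone ⟨by nlinarith, by nlinarith⟩
      have hneg : (-Q).roots.countP (fun t => 0 < t) = 0 := by
        refine countP_pos_roots_eq_zero_of_coeff_nonneg (-Q) fun i => ?_
        rw [coeff_neg, hc i, hb1z]
        have h0 : (if i = d 0 then b 0 else 0) ≤ 0 := by split_ifs <;> linarith
        have h1 : (if i = d 1 then (0 : ℝ) else 0) = 0 := by split_ifs <;> rfl
        have h2 : (if i = d 2 then b 2 else 0) ≤ 0 := by split_ifs <;> linarith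
        linarith
      rw [roots_neg] at hneg
      omega

/-- **Descartes for a ONE-CHANGE trinomial row** (`d 0 < d 1 < d 2`, no strict dip `b₀b₁ < 0 ∧ b₁b₂ < 0`; types T1 / T4 / T5 / binomials and their
degenerations): at most ONE positive zero, counted with multiplicity. [folklore] -/
theorem countP_pos_roots_trinomial_le_one (d : Fin 3 → ℕ) (h01 : d 0 < d 1) (h12 : d 1 < d 2) (b : Fin 3 → ℝ)
    (hone : ¬ (b 0 * b 1 < 0 ∧ b 1 * b 2 < 0)) :
    (∑ l, C (b l) * X ^ (d l) : ℝ[X]).roots.countP (fun t => 0 < t) ≤ 1 := by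
  by_cases hb1 : 0 ≤ b 1
  · exact countP_pos_roots_trinomial_le_one_of_middle_nonneg d h01 h12 b hb1 hone
  · push Not at hb1
    -- negate the row: same roots, middle coefficient positive, same one-change hypothesis
    have hneg : (∑ l, C ((-b) l) * X ^ (d l) : ℝ[X]) = -(∑ l, C (b l) * X ^ (d l)) := by
      rw [← Finset.sum_neg_distrib]
      exact Finset.sum_congr rfl fun l _ => by simp [map_neg, neg_mul]
    have h := countP_pos_roots_trinomial_le_one_of_middle_nonneg d h01 h12 (-b) (by simp; exact hb1.le)
      (by simpa only [Pi.neg_apply, neg_mul_neg] using hone)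
    rwa [hneg, roots_neg] at h

/-- ★ **N3: a K = 3 company of ONE-CHANGE rows has at most `m` positive zeros of `∏_j f_j`** (so at most `m` poles of the Euler ratio):
`d 0 < d 1 < d 2`, every row without a strict dip. [this file's theorem] -/
theorem card_posRoots_prod_le_of_oneChange {m : ℕ} (d : Fin 3 → ℕ) (h01 : d 0 < d 1) (h12 : d 1 < d 2) (a : Fin m → Fin 3 → ℝ)
    (hone : ∀ j, ¬ (a j 0 * a j 1 < 0 ∧ a j 1 * a j 2 < 0)) :
    ((∏ j, ∑ l, C (a j l) * X ^ (d l) : ℝ[X]).roots.toFinset.filter (fun t => 0 < t)).card ≤ m := by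
  classical
  by_cases hP : (∏ j, ∑ l, C (a j l) * X ^ (d l) : ℝ[X]) = 0
  · rw [hP, roots_zero, Multiset.toFinset_zero, Finset.filter_empty, Finset.card_empty]; exact Nat.zero_le _
  refine (StubVLawTwo.card_filter_pos_le_countP _).trans ?_
  rw [roots_prod _ _ hP, Multiset.countP_eq_card_filter, Multiset.filter_bind, Multiset.card_bind]
  have hrow : ∀ j, ((∑ l, C (a j l) * X ^ (d l) : ℝ[X]).roots.filter (fun t => 0 < t)).card ≤ 1 := by
    intro j
    have h := countP_pos_roots_trinomial_le_one d h01 h12 (a j) (hone j)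
    rwa [Multiset.countP_eq_card_filter] at h
  have hsum : (Multiset.map (Multiset.card ∘ fun j => Multiset.filter (fun t => 0 < t) (∑ l, C (a j l) * X ^ (d l) : ℝ[X]).roots)
          (Finset.univ : Finset (Fin m)).val).sum
      = ∑ j : Fin m, ((∑ l, C (a j l) * X ^ (d l) : ℝ[X]).roots.filter (fun t => 0 < t)).card := by
    rw [Finset.sum_eq_multiset_sum]; rfl
  rw [hsum]
  calc ∑ j : Fin m, ((∑ l, C (a j l) * X ^ (d l) : ℝ[X]).roots.filter (fun t => 0 < t)).card
      ≤ ∑ _j : Fin m, 1 := Finset.sum_le_sum fun j _ => hrow j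
    _ = m := by simp

/-! ### §3 N2 + N3 — the floor as a budget on ONE polynomial -/

/-- ★★ **THE FLOOR AS A BUDGET ON ONE POLYNOMIAL** (K = 3, one-change company on `d 0 < d 1 < d 2`, EVERY coupling `l₀` at once, no window, no chart):
`Z₊(eulerNumerator d a l₀) ≤ Z₊(W(∏_j f_j)) + 2m + 1`, `W(P) = P·X(XP′)′ − (XP′)²`.  Consequently ANY bound `Z₊(W(∏_j fewnomial d (a j))) ≤ C·m + C` on one-change
companies (val-idea-25's EB2-W — CONJECTURE) gives `OneChangeFloorK3` with constant `C + 3`. [this file's theorem] -/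
theorem card_posRoots_eulerNumerator_le_wronskian_add_of_oneChange {m : ℕ} (d : Fin 3 → ℕ) (h01 : d 0 < d 1) (h12 : d 1 < d 2)
    (a : Fin m → Fin 3 → ℝ) (hone : ∀ j, ¬ (a j 0 * a j 1 < 0 ∧ a j 1 * a j 2 < 0)) (l₀ : Fin 3) :
    ((∑ j, (∑ l, C (a j l * ((d l : ℝ) - d l₀)) * X ^ (d l)) * ∏ i ∈ Finset.univ.erase j, (∑ l, C (a i l) * X ^ (d l))
        : ℝ[X]).roots.toFinset.filter (fun t => 0 < t)).card
      ≤ (((∏ j, ∑ l, C (a j l) * X ^ (d l) : ℝ[X]) * (X * derivative (X * derivative (∏ j, ∑ l, C (a j l) * X ^ (d l) : ℝ[X])))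
            - (X * derivative (∏ j, ∑ l, C (a j l) * X ^ (d l) : ℝ[X])) ^ 2).roots.toFinset.filter (fun t => 0 < t)).card
        + 2 * m + 1 := by
  have h1 := card_posRoots_eulerNumerator_le_wronskian_add d a l₀
  have h2 := card_posRoots_prod_le_of_oneChange d h01 h12 a hone
  omega

end ProductPlusOne

end Summit.ValiantsHypothesis.ValiantsHypothesis.Theorems.LacunarySymmetroidMatrixDescartes
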